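import Summits.CriticalPhenomena.PercolationContinuityZ3.Theorems.PercNearOneGluingNoHeavyConstsMDLXJointXEdge
import Summits.CriticalPhenomena.PercolationContinuityZ3.Theorems.PercNearOneGluingNoHeavyConstsCrossExchange
import HarnessLib

/-!
# The pinned-binding conjecture (P_pin) and the reduction of the u = z CROSS member to the pinned class
# (PAPER-2 track (ii): constants of the CSH family; seat `prim-consts-2`, gen 24)

builds on p205010 (kernel theorem, internal audit signed; external expert review pending).  Support file (`--supports
stmt-CriticalPhenomena-4575`); memos `run/shared/lean/prim/consts/FROM-prim-consts-2-g23-PINNED-BINDING.md` §0(1)–(2) and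
`FROM-prim-consts-2-g24-CYLINDER-EVENTS.md` §0(2).  One `@[conjecture] def` (a typed conjecture, like `Consts.MDLXJoint` / `Consts.CrossRel`) and
one theorem; no sorries; standard axioms.

SETTING.  `μ = prodBernoulli w`, owner `s`, markers `y, z`, avoided set `X`, `D = {s ↮ X}`, `Z = {s~z}`, `Y = {s~y}`; monotone 0/1-valued
functionals `F` of the open edge cluster `C_s` (= up-sets of the cluster poset); PINNED: `F(C_s) = 1 ⟹ s~y`.  Cells `ζ = μ(D∩Z)`,
`b = μ(D∩Y∩Zᶜ)`, `n = μ(D∩Yᶜ∩Zᶜ)`; restricted integrals `I_Z(F) = ∫_{D∩Z} F(C_s)`, `I_{YZᶜ}(F) = ∫_{D∩Zᶜ∩Y} F(C_s)`, `I_N(F) = ∫_{D∩Zᶜ∩Yᶜ} F(C_s)`,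
and for weights `α, β, γ ≥ 0` the linear functional `Ψ(F) = α·I_Z(F) − β·I_{YZᶜ}(F) − γ·I_N(F)`.
* `Consts.PinnedBinding` — **CONJECTURE (P_pin), lattice form.**  If `β·b + γ·n ≤ α·ζ` (the pencil `Ψ(1) ≥ 0`; with equality and
  `θ = βb/(αζ)` this is `Φ_θ(U) = ν(U|Z) − θν(U|Y,Zᶜ) − (1−θ)ν(U|Yᶜ,Zᶜ)` of the memos, up to the factor `αζ`), then for every `m`:
  `Ψ ≥ m` on the PINNED monotone 0/1 functionals implies `Ψ ≥ m` on ALL monotone 0/1 functionals — the minimum of `Ψ` over the up-sets of the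
  cluster poset is attained on the pinned sub-lattice.  EVIDENCE (exact rationals, gens 23–24): ratio form 14 720 + 2 400 instances (kit
  j216292/j216293, n ≤ 8, |X| ≤ 2) and 1 920 adversarial climbs, 0 exceptions; all-θ lattice form 4 650 tests (X = ∅) + Ψ-form with `|X| ≤ 2`
  6 240 tests, 0 exceptions; exhaustive up-set enumeration: every minimiser is pinned when the minimum is negative (129/129), local form
  `Ψ(U) ≥ min over pinned U′ ⊆ U` 0/3 681.  Refuted neighbours: θ-uniform partners, single-principal partners, Boolean-lattice analogue (memos).
* `Consts.crossM2_of_pinnedBinding` — **THEOREM (the reduction).  `PinnedBinding` and the pinned class (`M₂ ≥ 0` at every pinned monotone 0/1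
  `F`: `Consts.crossRel_edge_M2_of_markerPinned`, in the tree) give the u = z CROSS member `M₂(X)(F) ≥ 0` for EVERY monotone 0/1 functional `F`**
  (the pinned class enters as a hypothesis so that this file does not depend on the edge-exchange files).  Mechanism: for every `F`,
  `M₂(X)(F) = Ψ(F)` with `α = a_X(b+n)`, `β = a_Xζ + b_X n`, `γ = a_Xζ − b_X b` (`a_X = μ(y↮{s}∪X∪{z}, s↮X∪{z})`, `b_X = μ(y~z, y↮{s}∪X, s↮X)`),
  `βb + γn = αζ`, and `γ ≥ 0` is the cross-conditioning exchange `Consts.crossExchange` (`b_X·b ≤ a_X·μ(s~y,s~z,s↮X) ≤ a_X·ζ`).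
[cite: VandenbergHaggstromKahn2005, Thm. 1.1 and its proof (pp. 3–5), Thm. 1.3 (p. 6)] [status: open]
-/

noncomputable section

namespace Summit.CriticalPhenomena.PercolationContinuityZ3.Theorems

open MeasureTheory Set Literature.Probability.LatticeModels Literature.Probability.Percolation
open scoped Classical

namespace Consts

/-- **CONJECTURE (P_pin), the pinned-binding conjecture in lattice form.**  For `μ = prodBernoulli w`, `s, y, z`, avoided set `X`,
`D = {s↮X}`, weights `α, β, γ ≥ 0` with `β·μ(D∩Zᶜ∩Y) + γ·μ(D∩Zᶜ∩Yᶜ) ≤ α·μ(D∩Z)` and any level `m`: if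
`α∫_{D∩Z}F − β∫_{D∩Zᶜ∩Y}F − γ∫_{D∩Zᶜ∩Yᶜ}F ≥ m` for every PINNED monotone 0/1 functional `F` of the open edge cluster of `s`
(`F(C_s) = 1 ⟹ s~y`), then the same holds for every monotone 0/1 functional.  Census: memos g23 §0(2), g24 §0(2) (0 exceptions).
[cite: VandenbergHaggstromKahn2005, Thm. 1.3 (p. 6)] [status: open] -/
@[conjecture] def PinnedBinding : Prop :=
  ∀ (n : ℕ) (w : Sym2 (Fin n) → unitInterval) (s y z : Fin n) (X : Set (Fin n)) (α β γ m : ℝ),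
    0 ≤ α → 0 ≤ β → 0 ≤ γ →
    β * (prodBernoulli w).real ({ω : BondConfig (Fin n) | ∀ x ∈ insert z X, ¬ (openGraph ω).Reachable s x} ∩ openConn s y) +
        γ * (prodBernoulli w).real {ω : BondConfig (Fin n) | (∀ x ∈ insert z X, ¬ (openGraph ω).Reachable s x) ∧
          ¬ (openGraph ω).Reachable s y} ≤
      α * (prodBernoulli w).real ({ω : BondConfig (Fin n) | ∀ x ∈ X, ¬ (openGraph ω).Reachable s x} ∩ openConn s z) →
    (∀ F : Set (Sym2 (Fin n)) → ℝ, Monotone F → (∀ C, F C = 0 ∨ F C = 1) →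
      (∀ ω : BondConfig (Fin n), F (openEdgeCluster ω s) = 1 → (openGraph ω).Reachable s y) →
      m ≤ α * (∫ ω in {ω : BondConfig (Fin n) | ∀ x ∈ X, ¬ (openGraph ω).Reachable s x} ∩ openConn s z,
              F (openEdgeCluster ω s) ∂(prodBernoulli w)) -
          β * (∫ ω in {ω : BondConfig (Fin n) | ∀ x ∈ insert z X, ¬ (openGraph ω).Reachable s x} ∩ openConn s y,
              F (openEdgeCluster ω s) ∂(prodBernoulli w)) -
          γ * (∫ ω in {ω : BondConfig (Fin n) | (∀ x ∈ insert z X, ¬ (openGraph ω).Reachable s x) ∧ ¬ (openGraph ω).Reachable s y},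
              F (openEdgeCluster ω s) ∂(prodBernoulli w))) →
    ∀ F : Set (Sym2 (Fin n)) → ℝ, Monotone F → (∀ C, F C = 0 ∨ F C = 1) →
      m ≤ α * (∫ ω in {ω : BondConfig (Fin n) | ∀ x ∈ X, ¬ (openGraph ω).Reachable s x} ∩ openConn s z,
              F (openEdgeCluster ω s) ∂(prodBernoulli w)) -
          β * (∫ ω in {ω : BondConfig (Fin n) | ∀ x ∈ insert z X, ¬ (openGraph ω).Reachable s x} ∩ openConn s y,
              F (openEdgeCluster ω s) ∂(prodBernoulli w)) -
          γ * (∫ ω in {ω : BondConfig (Fin n) | (∀ x ∈ insert z X, ¬ (openGraph ω).Reachable s x) ∧ ¬ (openGraph ω).Reachable s y},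
              F (openEdgeCluster ω s) ∂(prodBernoulli w))

/-- **THE u = z CROSS MEMBER FOLLOWS FROM (P_pin) AND THE PINNED CLASS.**  If `Consts.PinnedBinding` holds and (the pinned class, in the tree as
`Consts.crossRel_edge_M2_of_markerPinned`) `M₂(X)(F′) ≥ 0` for every pinned monotone 0/1 functional `F′`, then `M₂(X)(F) ≥ 0` for EVERY monotone
0/1 functional `F` of the open edge cluster:
`0 ≤ polMargin μ s y z F (X∪z) (X∪z) X + polMargin μ s y z F (X∪z) X (X∪z) + polMargin μ s y z F X (X∪z) (X∪z)`.
[cite: VandenbergHaggstromKahn2005, Thm. 1.1 and its proof (pp. 3–5)] -/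
theorem crossM2_of_pinnedBinding (hPB : PinnedBinding) {n : ℕ} (w : Sym2 (Fin n) → unitInterval) (s y z : Fin n) (X : Set (Fin n))
    (hpin : ∀ F : Set (Sym2 (Fin n)) → ℝ, Monotone F → (∀ C, F C = 0 ∨ F C = 1) →
      (∀ ω : BondConfig (Fin n), F (openEdgeCluster ω s) = 1 → (openGraph ω).Reachable s y) →
      0 ≤ polMargin (prodBernoulli w) s y z F (insert z X) (insert z X) X +
            polMargin (prodBernoulli w) s y z F (insert z X) X (insert z X) +
          polMargin (prodBernoulli w) s y z F X (insert z X) (insert z X))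
    (F : Set (Sym2 (Fin n)) → ℝ) (hFm : Monotone F) (hF01 : ∀ C, F C = 0 ∨ F C = 1) :
    0 ≤ polMargin (prodBernoulli w) s y z F (insert z X) (insert z X) X +
          polMargin (prodBernoulli w) s y z F (insert z X) X (insert z X) +
        polMargin (prodBernoulli w) s y z F X (insert z X) (insert z X) := by
  set μ := prodBernoulli w with hμ
  -- the events and cells
  set D : Set (BondConfig (Fin n)) := {ω | ∀ x ∈ X, ¬ (openGraph ω).Reachable s x} with hD
  set Dz : Set (BondConfig (Fin n)) := {ω | ∀ x ∈ insert z X, ¬ (openGraph ω).Reachable s x} with hDz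
  set N : Set (BondConfig (Fin n)) := {ω | (∀ x ∈ insert z X, ¬ (openGraph ω).Reachable s x) ∧ ¬ (openGraph ω).Reachable s y} with hN
  set AX : Set (BondConfig (Fin n)) := {ω : BondConfig (Fin n) | ∀ x ∈ insert s (insert z X), ¬ (openGraph ω).Reachable y x} ∩ Dz
    with hAX
  set BX : Set (BondConfig (Fin n)) := {ω : BondConfig (Fin n) | ∀ x ∈ insert s X, ¬ (openGraph ω).Reachable y x} ∩ D ∩ openConn y z
    with hBX
  set aX := μ.real AX with haX
  set bX := μ.real BX with hbX
  set ζ := μ.real (D ∩ openConn s z) with hζ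
  set b := μ.real (Dz ∩ openConn s y) with hb
  set nn := μ.real N with hnn
  -- `M₂(X)(G) = Ψ(G)` for every functional `G`
  have hNeq : N = Dz \ openConn s y := by
    ext ω; simp only [hN, hDz, openConn, mem_setOf_eq, mem_sdiff]
  have hmDz : μ.real Dz = b + nn := by
    rw [hb, hnn, hNeq]; exact (measureReal_inter_add_sdiff (μ := μ) (s := Dz) (MeasurableSet.of_discrete : MeasurableSet (openConn s y))).symm
  have key : ∀ G : Set (Sym2 (Fin n)) → ℝ,
      polMargin μ s y z G (insert z X) (insert z X) X + polMargin μ s y z G (insert z X) X (insert z X) +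
          polMargin μ s y z G X (insert z X) (insert z X) =
        aX * (b + nn) * (∫ ω in D ∩ openConn s z, G (openEdgeCluster ω s) ∂μ) -
          (aX * ζ + bX * nn) * (∫ ω in Dz ∩ openConn s y, G (openEdgeCluster ω s) ∂μ) -
          (aX * ζ - bX * b) * (∫ ω in N, G (openEdgeCluster ω s) ∂μ) := by
    intro G
    have hIDz : (∫ ω in Dz, G (openEdgeCluster ω s) ∂μ) =
        (∫ ω in Dz ∩ openConn s y, G (openEdgeCluster ω s) ∂μ) + ∫ ω in N, G (openEdgeCluster ω s) ∂μ := by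
      rw [hNeq]; exact (integral_inter_add_sdiff (MeasurableSet.of_discrete : MeasurableSet (openConn s y)) Integrable.of_finite).symm
    unfold polMargin
    have hW : (AX ∩ openConn y z) = ∅ := by
      ext ω
      simp only [hAX, hDz, mem_inter_iff, mem_setOf_eq, forall_mem_insert, openConn, mem_empty_iff_false, iff_false]
      exact fun ⟨⟨⟨_, hyz, _⟩, _⟩, h⟩ => hyz h
    have hZ : (Dz ∩ openConn s z) = ∅ := by
      ext ω
      simp only [hDz, mem_inter_iff, mem_setOf_eq, forall_mem_insert, openConn, mem_empty_iff_false, iff_false]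
      exact fun ⟨⟨hsz, _⟩, h⟩ => hsz h
    simp only [← hD, ← hDz] at hW hZ ⊢
    rw [show ({ω : BondConfig (Fin n) | ∀ x ∈ insert s (insert z X), ¬ (openGraph ω).Reachable y x} ∩ Dz) = AX from rfl] at *
    rw [hW, hZ, hIDz, hmDz]
    simp only [measureReal_empty, Measure.restrict_empty, integral_zero_measure]
    ring
  -- `γ ≥ 0`: the cross-conditioning exchange
  have hγ : bX * b ≤ aX * ζ := by
    have hx := crossExchange w s y z X X
    have e1 : {ω : BondConfig (Fin n) | (openGraph ω).Reachable y z ∧ ¬ (openGraph ω).Reachable y s ∧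
        (∀ x ∈ X, ¬ (openGraph ω).Reachable y x) ∧ (∀ x ∈ X, ¬ (openGraph ω).Reachable s x)} = BX := by
      ext ω
      simp only [hBX, hD, openConn, mem_inter_iff, mem_setOf_eq, forall_mem_insert]
      tauto
    have e2 : {ω : BondConfig (Fin n) | (openGraph ω).Reachable s y ∧ ¬ (openGraph ω).Reachable s z ∧
        (∀ x ∈ X, ¬ (openGraph ω).Reachable s x)} = Dz ∩ openConn s y := by
      ext ω
      simp only [hDz, openConn, mem_inter_iff, mem_setOf_eq, forall_mem_insert]
      tauto
    have e3 : {ω : BondConfig (Fin n) | ¬ (openGraph ω).Reachable y s ∧ ¬ (openGraph ω).Reachable y z ∧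
        ¬ (openGraph ω).Reachable s z ∧ (∀ x ∈ X ∪ X, ¬ (openGraph ω).Reachable y x) ∧
        (∀ x ∈ X ∪ X, ¬ (openGraph ω).Reachable s x)} = AX := by
      ext ω
      simp only [hAX, hDz, union_self, mem_inter_iff, mem_setOf_eq, forall_mem_insert]
      tauto
    have e4 : (prodBernoulli w).real {ω : BondConfig (Fin n) | (openGraph ω).Reachable s y ∧ (openGraph ω).Reachable s z ∧
        (∀ x ∈ X ∩ X, ¬ (openGraph ω).Reachable s x)} ≤ ζ := by
      refine measureReal_mono (fun ω hω => ?_)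
      simp only [inter_self, mem_setOf_eq] at hω
      exact ⟨fun x hx => hω.2.2 x hx, hω.2.1⟩
    rw [e1, e2, e3] at hx
    calc bX * b = (prodBernoulli w).real BX * (prodBernoulli w).real (Dz ∩ openConn s y) := by rw [hbX, hb]
      _ ≤ (prodBernoulli w).real AX * (prodBernoulli w).real {ω : BondConfig (Fin n) | (openGraph ω).Reachable s y ∧
            (openGraph ω).Reachable s z ∧ (∀ x ∈ X ∩ X, ¬ (openGraph ω).Reachable s x)} := hx
      _ ≤ aX * ζ := by rw [haX]; exact mul_le_mul_of_nonneg_left e4 measureReal_nonneg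
  -- apply (P_pin) with `m = 0` and the weights of `M₂`
  have h := hPB n w s y z X (aX * (b + nn)) (aX * ζ + bX * nn) (aX * ζ - bX * b) 0
    (mul_nonneg measureReal_nonneg (add_nonneg measureReal_nonneg measureReal_nonneg))
    (add_nonneg (mul_nonneg measureReal_nonneg measureReal_nonneg) (mul_nonneg measureReal_nonneg measureReal_nonneg))
    (sub_nonneg.2 hγ) (le_of_eq (by rw [← hb, ← hnn, ← hζ]; ring))
    (fun G hGm hG01 hGY => by rw [← key G]; exact hpin G hGm hG01 hGY) F hFm hF01
  rw [key F]
  exact h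

end Consts

end Summit.CriticalPhenomena.PercolationContinuityZ3.Theorems

end
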